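import Summits.QuantumFields.YangMills.Theorems.BalabanUVNodesN15PerCubeGreenFineSummand
import HarnessLib

/-!
# N15 = NE2, road (c) — PROGRAMME (PC), (PC-E-N): THE NAMED SCALAR COVARIANT GREEN's FUNCTION — `invOp A` = THE two-sided inverse of a linear endomorphism (unique when it exists),
# `scGreenOp U := invOp (Δ_{R_U} + a·Q′_TᵀQ′_T)` on the coarse (PC) site carrier and `scGreenOp′ U′` on the fine one: the gauge-choice-FREE name every (PC-E) conclusion is restated
# for (dag-n15-c g35, n15-c∕388)

Cell `pub-ymgap`, seat `pub-ymgap-dag-n15-c` (generation g35; R134 (a) seat, strategy s1 «first missing estimate»; HUMAN RULING D-0062; chair R424 venue).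
`bears_on: R4∕N15 · K3⁸ SpineGivenEndpointR13SepCoPHV (stmt-QuantumFields-27366)`; filed `--kind definition --supports stmt-QuantumFields-27366 --as helper` — COUNT-NEUTRAL
(definitions: reviewed ∕ async-audit lane).  3 `def`, 8 theorems, 0 `sorry`, 0 `instance`; [folklore] linear algebra + naming.  Imports BY NAME n15-c∕260b′ `…PerCubeGreenFineSummand`
(`scP′`; through it n15-c∕260b `…PerCubeGreenSummand` (`scP`), the (PC) site carriers `ScX`∕`ScX′`∕`scShift`∕`scShift′`, n15-b `covLapM`, dag-n15-w2 `gaugePair`, `coordMat`);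
nothing in the tree is modified, no landed name re-declared.

WHY (the (PC-E-N) programme; see n15-c∕387's header).  The glued operator `scGlued … w U P N_V` of the (PC) chain carries the per-cube gauges `w` in its very expression, and the
(PC-E) rate theorems (n15-c∕374∕375 entry 0, n15-c∕386 entry 3) produce those gauges EXISTENTIALLY — two theorems, two opaque gauge systems.  But n15-c∕262∕262′ (and n15-c∕387 for
the pair) prove that the glued operator is a TWO-SIDED INVERSE of Bałaban's `Δ′_a(U) = Δ_{R_U} + a·Q′_TᵀQ′_T` ([B9] (3.24)–(3.25)), and a two-sided inverse is unique
(`inverse_unique`: `G = G(AG′) = (GA)G′ = G′`).  So `G′(U)` HAS A NAME that mentions no gauge: `invOp (Δ′_a(U))`, and `eq_scGreenOp_of_inverse` rewrites any glued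
operator with the two identities into it.  The node's kernel family (n15-c g35 `…PerCubeGreenNodeObjects`) is built on these names, so its four entries are entries of ONE operator.

CONTENTS.
* §1 `invOp A` (`:= h.choose` if `∃ G, G∘A = 1 ∧ A∘G = 1`, else `0`); `inverse_unique`; `invOp_eq_of_inverse`; `invOp_comp_self`∕`self_comp_invOp` (under existence).
* §2 `scGreenOp d L mv kk hL a η ι e U := invOp (covLapM (scShift …) η (gaugePair (scShift …) (Ad∘U)) + scP … a ι e U)` and the fine twin `scGreenOp′`; `eq_scGreenOp_of_inverse` ∕
  `eq_scGreenOp'_of_inverse` (ANY `G` with the two identities IS the named operator), `scGreenOp_comp`∕`comp_scGreenOp` (the identities for the name, given one inverse).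

HONEST FRAMING ∕ LIMITS.  Naming + [folklore] uniqueness of inverses; nothing estimated, nothing of [B9] asserted; `Δ′_a(U)` here is the MODEL operator of the (PC) chain (n15-b's
`covLapM` species (3.50) at the adjoint transporters + Bałaban's summand `a·Q′_TᵀQ′_T` on King's doubled-torus cover), NOT the printed one.  NE2⁺ NOT PRINTED, NOT proved; N15 of record
untouched (DISCHARGED AS CONSUMED, p687738); K3⁸ OPEN; counts of record UNMOVED (typed 28∕28 · discharged 8∕27); one finite 𝕋⁴ at fixed ε per index — NOT infinite volume, NOT OS on
ℝ⁴, NOT a mass gap, NOT Clay.  Restate-immune (no Theses import).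
-/

set_option autoImplicit false

noncomputable section

open scoped BigOperators Matrix Matrix.Norms.L2Operator

namespace Summit.QuantumFields.YangMills.BalabanUVNodes.N15.Gluing

open Summit.QuantumFields.YangMills.BalabanUVNodes.N15.BackgroundLayer (covLapM)
open Summit.QuantumFields.YangMills.BalabanUVNodes.N15.MatrixSpecies (coordMat)
open Summit.QuantumFields.YangMills.BalabanUVNodes.N15.CurvedSpecies (gaugePair)

/-! ## §1 The two-sided inverse of a linear endomorphism, as a total function -/

section Inverse

variable {V : Type*} [AddCommGroup V] [Module ℝ V]

open Classical in
/-- THE TWO-SIDED INVERSE of a linear endomorphism `A`, as a total function: the (unique) `G` with `G ∘ A = 1` and `A ∘ G = 1` when one exists, `0` otherwise. [folklore] -/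
def invOp (A : V →ₗ[ℝ] V) : V →ₗ[ℝ] V :=
  if h : ∃ G : V →ₗ[ℝ] V, G ∘ₗ A = LinearMap.id ∧ A ∘ₗ G = LinearMap.id then h.choose else 0

/-- Uniqueness of two-sided inverses: a left inverse and a right inverse of the same map coincide (`G = G(AG′) = (GA)G′ = G′`). [folklore] -/
theorem inverse_unique {A G G' : V →ₗ[ℝ] V} (h1 : G ∘ₗ A = LinearMap.id) (h2 : A ∘ₗ G' = LinearMap.id) : G = G' := by
  calc G = G ∘ₗ (A ∘ₗ G') := by rw [h2, LinearMap.comp_id]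
    _ = (G ∘ₗ A) ∘ₗ G' := (LinearMap.comp_assoc G' A G).symm
    _ = G' := by rw [h1, LinearMap.id_comp]

/-- ★ `invOp A` IS any two-sided inverse of `A`. [folklore] -/
theorem invOp_eq_of_inverse {A G : V →ₗ[ℝ] V} (h1 : G ∘ₗ A = LinearMap.id) (h2 : A ∘ₗ G = LinearMap.id) : invOp A = G := by
  have h : ∃ G' : V →ₗ[ℝ] V, G' ∘ₗ A = LinearMap.id ∧ A ∘ₗ G' = LinearMap.id := ⟨G, h1, h2⟩
  rw [invOp, dif_pos h]
  exact inverse_unique h.choose_spec.1 h2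

/-- Under existence of a two-sided inverse, `invOp A ∘ A = 1`. [folklore] -/
theorem invOp_comp_self {A : V →ₗ[ℝ] V} (h : ∃ G : V →ₗ[ℝ] V, G ∘ₗ A = LinearMap.id ∧ A ∘ₗ G = LinearMap.id) : invOp A ∘ₗ A = LinearMap.id := by
  obtain ⟨G, h1, h2⟩ := h
  rw [invOp_eq_of_inverse h1 h2, h1]

/-- Under existence of a two-sided inverse, `A ∘ invOp A = 1`. [folklore] -/
theorem self_comp_invOp {A : V →ₗ[ℝ] V} (h : ∃ G : V →ₗ[ℝ] V, G ∘ₗ A = LinearMap.id ∧ A ∘ₗ G = LinearMap.id) : A ∘ₗ invOp A = LinearMap.id := by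
  obtain ⟨G, h1, h2⟩ := h
  rw [invOp_eq_of_inverse h1 h2, h2]

end Inverse

/-! ## §2 The named scalar covariant Green's functions of the (PC) pair -/

section Named

variable (d : ℕ) (L : ℕ) [NeZero L] {mm : Type} [Fintype mm] [DecidableEq mm]

/-- ★ **THE NAMED SCALAR COVARIANT GREEN's FUNCTION `G′(U)` ON THE COARSE (PC) SITE CARRIER**: THE two-sided inverse of the model `Δ′_a(U) = Δ_{R_U} + a·Q′_TᵀQ′_T` — n15-b's covariant
Laplacian species at the adjoint transporters `R_U = Ad∘U` (in the coordinates `e`) plus Bałaban's covariant averaging summand — a name that mentions NO per-cube gauge.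
[cite: Balaban1985BackgroundPropagators, (3.24)–(3.25) p.394, (3.50) p.400 (shape)] -/
def scGreenOp (mv kk : ℕ) (hL : Odd L ∧ 1 < L) (a η : ℝ) (ι : Type) [Fintype ι] [DecidableEq ι] (e : Matrix mm mm ℂ ≃L[ℝ] (ι → ℝ))
    (U : Fin (d + 1) → ScX d L mv kk hL → Matrix mm mm ℂ) : (ScX d L mv kk hL × ι → ℝ) →ₗ[ℝ] (ScX d L mv kk hL × ι → ℝ) :=
  invOp (covLapM (scShift d L mv kk hL) η (gaugePair (scShift d L mv kk hL) (fun μ x => coordMat e (ContinuousLinearMap.mulLeftRight ℝ (Matrix mm mm ℂ) (U μ x) (U μ x)ᴴ))) +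
    scP d L mv kk hL a ι e U)

/-- ★ **THE NAMED SCALAR COVARIANT GREEN's FUNCTION `G′(U′)` ON THE FINE (PC) SITE CARRIER** (spacing index `r + k`). [cite: Balaban1985BackgroundPropagators, (3.24)–(3.25) p.394, (3.50) p.400 (shape)] -/
def scGreenOp' (mv kk r : ℕ) (hL : Odd L ∧ 1 < L) (a η : ℝ) (ι : Type) [Fintype ι] [DecidableEq ι] (e : Matrix mm mm ℂ ≃L[ℝ] (ι → ℝ))
    (U : Fin (d + 1) → ScX' d L mv kk r hL → Matrix mm mm ℂ) : (ScX' d L mv kk r hL × ι → ℝ) →ₗ[ℝ] (ScX' d L mv kk r hL × ι → ℝ) :=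
  invOp (covLapM (scShift' d L mv kk r hL) η (gaugePair (scShift' d L mv kk r hL) (fun μ x => coordMat e (ContinuousLinearMap.mulLeftRight ℝ (Matrix mm mm ℂ) (U μ x) (U μ x)ᴴ))) +
    scP' d L mv kk r hL a ι e U)

variable {d L} {mv kk r : ℕ} {hL : Odd L ∧ 1 < L} {a η : ℝ} {ι : Type} [Fintype ι] [DecidableEq ι] (e : Matrix mm mm ℂ ≃L[ℝ] (ι → ℝ))

/-- ★ ANY two-sided inverse of the coarse model operator IS the named Green's function — the rewriting rule that removes the per-cube gauges from the (PC-E) conclusions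
(with n15-c∕262 ∕ n15-c∕387 supplying the two identities for the glued operator). [folklore] -/
theorem eq_scGreenOp_of_inverse (U : Fin (d + 1) → ScX d L mv kk hL → Matrix mm mm ℂ) {G : (ScX d L mv kk hL × ι → ℝ) →ₗ[ℝ] (ScX d L mv kk hL × ι → ℝ)}
    (h1 : G ∘ₗ (covLapM (scShift d L mv kk hL) η (gaugePair (scShift d L mv kk hL) (fun μ x => coordMat e (ContinuousLinearMap.mulLeftRight ℝ (Matrix mm mm ℂ) (U μ x) (U μ x)ᴴ))) +
      scP d L mv kk hL a ι e U) = LinearMap.id)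
    (h2 : (covLapM (scShift d L mv kk hL) η (gaugePair (scShift d L mv kk hL) (fun μ x => coordMat e (ContinuousLinearMap.mulLeftRight ℝ (Matrix mm mm ℂ) (U μ x) (U μ x)ᴴ))) +
      scP d L mv kk hL a ι e U) ∘ₗ G = LinearMap.id) :
    G = scGreenOp d L mv kk hL a η ι e U :=
  (invOp_eq_of_inverse h1 h2).symm

/-- ★ The fine twin of `eq_scGreenOp_of_inverse` (n15-c∕262′ ∕ n15-c∕387 supply the identities). [folklore] -/
theorem eq_scGreenOp'_of_inverse (U : Fin (d + 1) → ScX' d L mv kk r hL → Matrix mm mm ℂ) {G : (ScX' d L mv kk r hL × ι → ℝ) →ₗ[ℝ] (ScX' d L mv kk r hL × ι → ℝ)}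
    (h1 : G ∘ₗ (covLapM (scShift' d L mv kk r hL) η (gaugePair (scShift' d L mv kk r hL) (fun μ x => coordMat e (ContinuousLinearMap.mulLeftRight ℝ (Matrix mm mm ℂ) (U μ x) (U μ x)ᴴ))) +
      scP' d L mv kk r hL a ι e U) = LinearMap.id)
    (h2 : (covLapM (scShift' d L mv kk r hL) η (gaugePair (scShift' d L mv kk r hL) (fun μ x => coordMat e (ContinuousLinearMap.mulLeftRight ℝ (Matrix mm mm ℂ) (U μ x) (U μ x)ᴴ))) +
      scP' d L mv kk r hL a ι e U) ∘ₗ G = LinearMap.id) :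
    G = scGreenOp' d L mv kk r hL a η ι e U :=
  (invOp_eq_of_inverse h1 h2).symm

/-- The named coarse Green's function inverts the model operator on both sides, given ONE two-sided inverse (e.g. the glued operator of n15-c∕262). [folklore] -/
theorem scGreenOp_comp (U : Fin (d + 1) → ScX d L mv kk hL → Matrix mm mm ℂ) {G : (ScX d L mv kk hL × ι → ℝ) →ₗ[ℝ] (ScX d L mv kk hL × ι → ℝ)}
    (h1 : G ∘ₗ (covLapM (scShift d L mv kk hL) η (gaugePair (scShift d L mv kk hL) (fun μ x => coordMat e (ContinuousLinearMap.mulLeftRight ℝ (Matrix mm mm ℂ) (U μ x) (U μ x)ᴴ))) +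
      scP d L mv kk hL a ι e U) = LinearMap.id)
    (h2 : (covLapM (scShift d L mv kk hL) η (gaugePair (scShift d L mv kk hL) (fun μ x => coordMat e (ContinuousLinearMap.mulLeftRight ℝ (Matrix mm mm ℂ) (U μ x) (U μ x)ᴴ))) +
      scP d L mv kk hL a ι e U) ∘ₗ G = LinearMap.id) :
    scGreenOp d L mv kk hL a η ι e U ∘ₗ (covLapM (scShift d L mv kk hL) η (gaugePair (scShift d L mv kk hL) (fun μ x => coordMat e (ContinuousLinearMap.mulLeftRight ℝ (Matrix mm mm ℂ) (U μ x) (U μ x)ᴴ))) +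
        scP d L mv kk hL a ι e U) = LinearMap.id ∧
      (covLapM (scShift d L mv kk hL) η (gaugePair (scShift d L mv kk hL) (fun μ x => coordMat e (ContinuousLinearMap.mulLeftRight ℝ (Matrix mm mm ℂ) (U μ x) (U μ x)ᴴ))) +
        scP d L mv kk hL a ι e U) ∘ₗ scGreenOp d L mv kk hL a η ι e U = LinearMap.id := by
  rw [← eq_scGreenOp_of_inverse e U h1 h2]
  exact ⟨h1, h2⟩

/-- The fine twin of `scGreenOp_comp`. [folklore] -/
theorem scGreenOp'_comp (U : Fin (d + 1) → ScX' d L mv kk r hL → Matrix mm mm ℂ) {G : (ScX' d L mv kk r hL × ι → ℝ) →ₗ[ℝ] (ScX' d L mv kk r hL × ι → ℝ)}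
    (h1 : G ∘ₗ (covLapM (scShift' d L mv kk r hL) η (gaugePair (scShift' d L mv kk r hL) (fun μ x => coordMat e (ContinuousLinearMap.mulLeftRight ℝ (Matrix mm mm ℂ) (U μ x) (U μ x)ᴴ))) +
      scP' d L mv kk r hL a ι e U) = LinearMap.id)
    (h2 : (covLapM (scShift' d L mv kk r hL) η (gaugePair (scShift' d L mv kk r hL) (fun μ x => coordMat e (ContinuousLinearMap.mulLeftRight ℝ (Matrix mm mm ℂ) (U μ x) (U μ x)ᴴ))) +
      scP' d L mv kk r hL a ι e U) ∘ₗ G = LinearMap.id) :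
    scGreenOp' d L mv kk r hL a η ι e U ∘ₗ (covLapM (scShift' d L mv kk r hL) η (gaugePair (scShift' d L mv kk r hL) (fun μ x => coordMat e (ContinuousLinearMap.mulLeftRight ℝ (Matrix mm mm ℂ) (U μ x) (U μ x)ᴴ))) +
        scP' d L mv kk r hL a ι e U) = LinearMap.id ∧
      (covLapM (scShift' d L mv kk r hL) η (gaugePair (scShift' d L mv kk r hL) (fun μ x => coordMat e (ContinuousLinearMap.mulLeftRight ℝ (Matrix mm mm ℂ) (U μ x) (U μ x)ᴴ))) +
        scP' d L mv kk r hL a ι e U) ∘ₗ scGreenOp' d L mv kk r hL a η ι e U = LinearMap.id := by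
  rw [← eq_scGreenOp'_of_inverse e U h1 h2]
  exact ⟨h1, h2⟩

end Named

end Summit.QuantumFields.YangMills.BalabanUVNodes.N15.Gluing

end
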